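import Mathlib
import Literature.NumberTheory.LFunctions.Zhang2022.Section16Eq1616R2E
import HarnessLib

/-!
# Zhang (2022) §16 (16.15)→(16.16): the h16_16 chain with the smoothing steps u040a/u040b at the rate
# `O(𝓛⁻⁴)` (instead of the printed `O(𝓛⁻¹⁰)`), at every value of the parameter `e″₁ⱼ`

Topic `Literature/NumberTheory/LFunctions/Zhang2022` (Landau–Siegel audit tree; verdict-neutral).
Y. Zhang, *Discrete mean estimates and the Landau–Siegel zero*, arXiv:2211.02515v1 (2022)
[Zhang2022LandauSiegel] — **an unrefereed manuscript under adjudication**; the displays referred to are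
CLAIM nodes of `Typed.Section16B` / `TypedSection16BE`, stated not asserted; nothing here bears on
Theorems 1–2 of the source or on Landau–Siegel zeros. ZHANG-L discharge lane (seat zl-libC-typer, R-10
float; helper under leaf h16_16, binder of record `Typed.Section16B.Eq16_16R2E e1ppD c′`, RT-03 × RT-05).

WHY (zl-libC-p5 FINDING 2026-08-27T00:40Z, numbers): the sub-leaf `Typed.Section16B.Step16_u040a`
(§16 p. 94, tex L4657: "`Σ_{n<T} ϖ₂ⱼ(n)(ν∗χ)(n)/n = Σ_n ϖ₂ⱼ(ν∗χ)(n)n⁻¹g(T/n) + O(1/𝓛¹⁰)`", "By (4.2) and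
(4.3)") is typed with the PRINTED rate `C·𝓛⁻¹⁰`, but the D-uniform unsmoothing route (Gaussian transition
window `≈ 𝓛⁻¹⁵ ×` the mean of the multiplicative majorant of `|ϖ₂ⱼ(ν∗χ)|`, prime value `6` when `χ(p) = 1`)
yields `C·𝓛^{−9.5}` — it misses `𝓛⁻¹⁰` by `𝓛^{1/2}`, and the `𝓛⁻¹⁰` is reachable only through an
(A)-dependent `≈ 1 200`-line route. The CONSUMER, however, needs far less: the tree's
`Typed.Section16B.sumLtT_eval_of_repair` uses u040a (and u040b) ONLY through `(ell D ^ 10)⁻¹ ≤ (ell D ^ 4)⁻¹`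
(TypedSection16B.lean:1834), the rate of the repaired u041 being `O((1+|L′|)³𝓛⁻⁴)` anyway. This file makes
that slack available BY STATEMENT, with NO new definition: every theorem below takes the two smoothing steps
as INLINE hypotheses at the rate `C·(ell D ^ 4)⁻¹` — the bodies of `Step16_u040a` / `Step16_u040b` verbatim
with `(ell D ^ 10)⁻¹ ↦ (ell D ^ 4)⁻¹` — and concludes the SAME nodes as the chain of record; the typed nodes
imply the weak hypotheses (`step16_u040a_rate4_of`, `step16_u040b_rate4_of`), so nothing already landed or
planned is invalidated. Whether u040a is booked against print at `𝓛⁻¹⁰` or `𝓛⁻⁴` is a WP-internal reading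
matter (R-20; G-row bookkeeping); the leaf binder `Eq16_16R2E e1ppD c′` and everything above it are unchanged.
PROVED here (theorems only; no definitions, no named facts; constant-agnostic in `e1pp`, R-28 C4):

* `step16_u040a_rate4_of`, `step16_u040b_rate4_of` — the typed nodes (rate `𝓛⁻¹⁰`) imply the rate-`𝓛⁻⁴`
  inline forms (`𝓛 ≥ 1` for `D ≥ 3`);
* `sumLtT_eval_of_repair_rate4` — `u040a@𝓛⁻⁴ ∧ u040b@𝓛⁻⁴ ∧ Step16_u041aR ∧ Step16_u041bR ⇒
  Σ_{n<T} ϖ₂ⱼ(ν∗χ)(n)/n = (𝔞/𝔭)(φ(D)/D)L′(1,χ) + O((1+|L′|)³𝓛⁻⁴)` (the conclusion of `sumLtT_eval_of_repair`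
  VERBATIM; its bookkeeping with `h10` dropped);
* `step16_u042R2E_of_sumLtT` — `Eq16_15E e1pp → Inline16_nsetRemovableE e1pp → (that conclusion) →
  Step16_u042R2E e1pp` (the algebra of `step16_u042R2E_of_repair`, with the smoothed-sum evaluation as a
  hypothesis, so that ANY producer of it plugs);
* `step16_u042R2E_of_repair_rate4`, **`eq16_16R2E_of_subleaves_rate4 (e1pp) (c′) : Eq16_15E e1pp c′ →
  Inline16_nsetRemovableE e1pp c′ → (u040a@𝓛⁻⁴) → (u040b@𝓛⁻⁴) → Step16_u041aR c′ → Lemma162R c′ →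
  Eq16_16R2E e1pp c′`** — the RT-03 × RT-05 internal assembly with the weak smoothing steps (Lemma 16.1 =
  `AppendixA.lemma161_holds`; `Step16_u041bR ⇐ Lemma162R` as in the chain of record);
* `eq16_16R2_of_subleaves_rate4` — the printed-constant instance (`e1pp = e1ppj`, bridges `rfl`), concluding
  the v23+ binder `Typed.Section16B.Eq16_16R2 c′`;
* `inline16_nsetRemovableE_of_core` / `inline16_nsetRemovable_of_core` — the `𝔫(𝔮)`-removal node at EVERY
  parameter from its `𝔢`-FREE core `‖Σ_{n₁<T,n₁∈𝒩(𝔮)} − Σ_{n₁<T}‖ ≤ C𝓛⁻¹` (one proof serves `e1ppj` and `e1ppD`), and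
  `eq16_16R2E_of_subleaves_core` — the most permissive assembly (core + rate-`𝓛⁻⁴` smoothing steps);
* `eq16_16R2_of_eq16_16` — R-23 vs-PRINT kernel certificate for RT-03: the PRINTED (16.16) `Eq16_16 c′` implies
  the binder of record `Eq16_16R2 c′` (zl-ref-x's ask 00:01:42Z).

So a closer of `u040a` at rate `C·(ell D ^ 4)⁻¹` (zl-libC-p5's route (a), D-uniform, Q-19 + Shiu bridge) closes
the h16_16 chain with no further change. vs PRINT (R-23): u040a/u040b WEAKER than print (rate `𝓛⁻⁴` for `𝓛⁻¹⁰`),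
implied by print; (16.16) REPAIRED-OF-RECORD (two-piece rate; constant at the parameter) as in `Section16Eq1616R2E`.

## References

* Y. Zhang, arXiv:2211.02515v1 (2022), §16 p. 94 (tex L4656–L4669), (16.15)–(16.16) pp. 94–95; §4 (4.2),
  (4.3); App. A p. 105. [cite: Zhang2022LandauSiegel, §16 pp.94–95]
-/

noncomputable section

open Complex Real
open Literature.NumberTheory.LFunctions.Zhang2022
open Literature.NumberTheory.LFunctions.Zhang2022.Skeleton
open Literature.NumberTheory.LFunctions.Zhang2022.Typed.Section16A

namespace Literature.NumberTheory.LFunctions.Zhang2022.Typed.Section16B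

variable (e1pp : ℕ → ℂ) (c' : ℝ)

/-! ## The typed smoothing steps imply their rate-`𝓛⁻⁴` forms -/

/-- `D ≥ 3 ⇒ 𝓛 ≥ 1`, hence `(𝓛¹⁰)⁻¹ ≤ (𝓛⁴)⁻¹`. [folklore] -/
private theorem ell_pow_ten_inv_le_pow_four_inv {D : ℕ} (hD3 : 3 ≤ D) :
    (ell D ^ 10)⁻¹ ≤ (ell D ^ 4)⁻¹ := by
  have hℓ : 1 ≤ ell D := by
    have h3 : (3 : ℝ) ≤ D := by exact_mod_cast hD3
    rw [ell, Real.le_log_iff_exp_le (by linarith)]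
    have := Real.exp_one_lt_d9
    linarith
  have hℓ0 : 0 < ell D := lt_of_lt_of_le zero_lt_one hℓ
  exact inv_anti₀ (pow_pos hℓ0 4) (pow_le_pow_right₀ hℓ (by norm_num))

/-- `D ≥ 3 ⇒ 0 < 𝓛`. [folklore] -/
private theorem ell_pos_of_three_le_W {D : ℕ} (hD3 : 3 ≤ D) : 0 < ell D := by
  have h3 : (3 : ℝ) ≤ D := by exact_mod_cast hD3
  rw [ell]
  exact Real.log_pos (by linarith)

/-- **The typed u040a (rate `𝓛⁻¹⁰`) implies u040a at rate `𝓛⁻⁴`** (the inline hypothesis shape used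
below). [cite: Zhang2022LandauSiegel, §16 p.94] -/
theorem step16_u040a_rate4_of (h : Step16_u040a c') :
    ∃ C : ℝ, ForAllLarge fun D _ χ => AssumptionA D χ → ∀ j ∈ ({1, 2} : Finset ℕ),
      ‖(∑ n ∈ Finset.Ico 1 ⌈bigT D⌉₊, varpi2 c' χ j n * nuConvChi χ n / (n : ℂ)) -
          ∑' n : ℕ, varpi2 c' χ j n * nuConvChi χ n / (n : ℂ) * (gW D (bigT D / n) : ℂ)‖ ≤
        C * (ell D ^ 4)⁻¹ := by
  obtain ⟨C, D₀, hC⟩ := h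
  refine ⟨max C 0, max D₀ 3, fun D _ χ hD hq hp hA j hj => ?_⟩
  have e := hC D χ (le_trans (le_max_left _ _) hD) hq hp hA j hj
  have h10 := ell_pow_ten_inv_le_pow_four_inv (le_trans (le_max_right _ _) hD)
  have h10' : 0 ≤ (ell D ^ 10)⁻¹ :=
    inv_nonneg.mpr (pow_nonneg (ell_pos_of_three_le_W (le_trans (le_max_right _ _) hD)).le 10)
  exact e.trans ((mul_le_mul_of_nonneg_right (le_max_left _ _) h10').trans
    (mul_le_mul_of_nonneg_left h10 (le_max_right _ _)))

/-- **The typed u040b (rate `𝓛⁻¹⁰`) implies u040b at rate `𝓛⁻⁴`**. [cite: Zhang2022LandauSiegel, §16 p.94] -/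
theorem step16_u040b_rate4_of (h : Step16_u040b c') :
    ∃ C : ℝ, ForAllLarge fun D _ χ => AssumptionA D χ → ∀ j ∈ ({1, 2} : Finset ℕ),
      ‖(∑' n : ℕ, varpi2 c' χ j n * nuConvChi χ n / (n : ℂ) * (gW D (bigT D / n) : ℂ)) -
          (1 / (2 * π) : ℂ) * ∫ v : ℝ, integrand16_u040 c' χ j (1 + v * I)‖ ≤ C * (ell D ^ 4)⁻¹ := by
  obtain ⟨C, D₀, hC⟩ := h
  refine ⟨max C 0, max D₀ 3, fun D _ χ hD hq hp hA j hj => ?_⟩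
  have e := hC D χ (le_trans (le_max_left _ _) hD) hq hp hA j hj
  have hD3 : 3 ≤ D := le_trans (le_max_right _ _) hD
  have h10 := ell_pow_ten_inv_le_pow_four_inv hD3
  have h10' : 0 ≤ (ell D ^ 10)⁻¹ := inv_nonneg.mpr (pow_nonneg (ell_pos_of_three_le_W hD3).le 10)
  exact e.trans ((mul_le_mul_of_nonneg_right (le_max_left _ _) h10').trans
    (mul_le_mul_of_nonneg_left h10 (le_max_right _ _)))

/-! ## The smoothed-sum evaluation with the smoothing steps at rate `𝓛⁻⁴` -/

/-- **`u040a@𝓛⁻⁴ ∧ u040b@𝓛⁻⁴ ∧ Step16_u041aR ∧ Step16_u041bR ⇒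
Σ_{n<T} ϖ₂ⱼ(n)(ν∗χ)(n)/n = (𝔞/𝔭)(φ(D)/D)L′(1,χ) + O((1+|L′(1,χ)|)³𝓛⁻⁴)`** — the conclusion of the tree's
`sumLtT_eval_of_repair` VERBATIM, from the two smoothing steps at the WEAKER rate `C·(ell D ^ 4)⁻¹` (the
original bookkeeping uses them only through `𝓛⁻¹⁰ ≤ 𝓛⁻⁴`; here that step is simply absent).
[cite: Zhang2022LandauSiegel, §16 p.94] -/
theorem sumLtT_eval_of_repair_rate4
    (h40a : ∃ C : ℝ, ForAllLarge fun D _ χ => AssumptionA D χ → ∀ j ∈ ({1, 2} : Finset ℕ),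
      ‖(∑ n ∈ Finset.Ico 1 ⌈bigT D⌉₊, varpi2 c' χ j n * nuConvChi χ n / (n : ℂ)) -
          ∑' n : ℕ, varpi2 c' χ j n * nuConvChi χ n / (n : ℂ) * (gW D (bigT D / n) : ℂ)‖ ≤
        C * (ell D ^ 4)⁻¹)
    (h40b : ∃ C : ℝ, ForAllLarge fun D _ χ => AssumptionA D χ → ∀ j ∈ ({1, 2} : Finset ℕ),
      ‖(∑' n : ℕ, varpi2 c' χ j n * nuConvChi χ n / (n : ℂ) * (gW D (bigT D / n) : ℂ)) -
          (1 / (2 * π) : ℂ) * ∫ v : ℝ, integrand16_u040 c' χ j (1 + v * I)‖ ≤ C * (ell D ^ 4)⁻¹)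
    (h41a : Step16_u041aR c') (h41b : Step16_u041bR c') :
    ∃ C : ℝ, ForAllLarge fun D _ χ => AssumptionA D χ → ∀ j ∈ ({1, 2} : Finset ℕ),
      ‖(∑ n ∈ Finset.Ico 1 ⌈bigT D⌉₊, varpi2 c' χ j n * nuConvChi χ n / (n : ℂ)) -
          (frakA χ : ℂ) / frakp χ * ((Nat.totient D : ℂ) / (D : ℂ)) * deriv χ.LFunction 1‖ ≤
        C * (1 + ‖deriv χ.LFunction 1‖) ^ 3 * (ell D ^ 4)⁻¹ := by
  obtain ⟨C₁, D₁, h₁⟩ := h40a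
  obtain ⟨C₂, D₂, h₂⟩ := h40b
  obtain ⟨C₃, D₃, h₃⟩ := h41a
  obtain ⟨C₄, D₄, h₄⟩ := h41b
  refine ⟨max C₁ 0 + max C₂ 0 + max C₃ 0 + max C₄ 0,
    max (max (max D₁ D₂) (max D₃ D₄)) 3, fun D _ χ hD hq hp hA j hj => ?_⟩
  have hD₁ : D₁ ≤ D :=
    le_trans (le_trans (le_max_left _ _) (le_max_left _ _)) (le_trans (le_max_left _ _) hD)
  have hD₂ : D₂ ≤ D :=
    le_trans (le_trans (le_max_right _ _) (le_max_left _ _)) (le_trans (le_max_left _ _) hD)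
  have hD₃ : D₃ ≤ D :=
    le_trans (le_trans (le_max_left _ _) (le_max_right _ _)) (le_trans (le_max_left _ _) hD)
  have hD₄ : D₄ ≤ D :=
    le_trans (le_trans (le_max_right _ _) (le_max_right _ _)) (le_trans (le_max_left _ _) hD)
  have hD3 : 3 ≤ D := le_trans (le_max_right _ _) hD
  have e₁ := h₁ D χ hD₁ hq hp hA j hj
  have e₂ := h₂ D χ hD₂ hq hp hA j hj
  have e₃ := h₃ D χ hD₃ hq hp hA j hj
  have e₄ := h₄ D χ hD₄ hq hp hA j hj
  rw [integral_integrand16_u040R_eq] at e₃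
  have hℓ : 1 ≤ ell D := by
    have h3 : (3 : ℝ) ≤ D := by exact_mod_cast hD3
    rw [ell, Real.le_log_iff_exp_le (by linarith)]
    have := Real.exp_one_lt_d9
    linarith
  have hℓ0 : 0 < ell D := lt_of_lt_of_le zero_lt_one hℓ
  have h4 : 0 ≤ (ell D ^ 4)⁻¹ := inv_nonneg.mpr (pow_nonneg hℓ0.le 4)
  -- abbreviations
  set Y := (1 + ‖deriv χ.LFunction 1‖) ^ 3 * (ell D ^ 4)⁻¹ with hY
  have hcube : 1 ≤ (1 + ‖deriv χ.LFunction 1‖) ^ 3 :=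
    one_le_pow₀ (le_add_of_nonneg_right (norm_nonneg _))
  have h4Y : (ell D ^ 4)⁻¹ ≤ Y := by
    calc (ell D ^ 4)⁻¹ = 1 * (ell D ^ 4)⁻¹ := (one_mul _).symm
      _ ≤ Y := mul_le_mul_of_nonneg_right hcube h4
  have hY0 : 0 ≤ Y := le_trans h4 h4Y
  set S := ∑ n ∈ Finset.Ico 1 ⌈bigT D⌉₊, varpi2 c' χ j n * nuConvChi χ n / (n : ℂ) with hS
  set W := ∑' n : ℕ, varpi2 c' χ j n * nuConvChi χ n / (n : ℂ) * (gW D (bigT D / n) : ℂ) with hW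
  set J := (1 / (2 * π) : ℂ) * ∫ v : ℝ, integrand16_u040 c' χ j (1 + v * I) with hJ
  set V := deriv χ.LFunction 1 ^ 3 * frakU2R c' χ j 1 with hV
  set M := (frakA χ : ℂ) / frakp χ * ((Nat.totient D : ℂ) / (D : ℂ)) * deriv χ.LFunction 1 with hM
  have hsplit : S - M = (S - W) + (W - J) + (J - V) + (V - M) := by ring
  calc ‖S - M‖ = ‖(S - W) + (W - J) + (J - V) + (V - M)‖ := by rw [hsplit]
    _ ≤ ‖S - W‖ + ‖W - J‖ + ‖J - V‖ + ‖V - M‖ := by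
        have t1 : ‖(S - W) + (W - J)‖ ≤ ‖S - W‖ + ‖W - J‖ := norm_add_le _ _
        have t2 : ‖(S - W) + (W - J) + (J - V)‖ ≤ ‖(S - W) + (W - J)‖ + ‖J - V‖ := norm_add_le _ _
        have t3 : ‖(S - W) + (W - J) + (J - V) + (V - M)‖ ≤ ‖(S - W) + (W - J) + (J - V)‖ + ‖V - M‖ :=
          norm_add_le _ _
        linarith
    _ ≤ max C₁ 0 * Y + max C₂ 0 * Y + max C₃ 0 * Y + max C₄ 0 * Y := by
        have b₁ : ‖S - W‖ ≤ max C₁ 0 * Y :=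
          le_trans e₁ (le_trans (mul_le_mul_of_nonneg_right (le_max_left _ _) h4)
            (mul_le_mul_of_nonneg_left h4Y (le_max_right _ _)))
        have b₂ : ‖W - J‖ ≤ max C₂ 0 * Y :=
          le_trans e₂ (le_trans (mul_le_mul_of_nonneg_right (le_max_left _ _) h4)
            (mul_le_mul_of_nonneg_left h4Y (le_max_right _ _)))
        have b₃ : ‖J - V‖ ≤ max C₃ 0 * Y := by
          refine le_trans e₃ ?_
          rw [mul_assoc]
          exact mul_le_mul_of_nonneg_right (le_max_left _ _) hY0
        have b₄ : ‖V - M‖ ≤ max C₄ 0 * Y := by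
          refine le_trans e₄ ?_
          rw [mul_assoc]
          exact mul_le_mul_of_nonneg_right (le_max_left _ _) hY0
        exact add_le_add (add_le_add (add_le_add b₁ b₂) b₃) b₄
    _ = (max C₁ 0 + max C₂ 0 + max C₃ 0 + max C₄ 0) * (1 + ‖deriv χ.LFunction 1‖) ^ 3 *
          (ell D ^ 4)⁻¹ := by rw [hY]; ring

/-- Any real threshold on `𝓛 = log D` is met for all large `D`. [folklore] -/
private theorem exists_forall_le_ell_W (M : ℝ) : ∃ D₀ : ℕ, ∀ D : ℕ, D₀ ≤ D → M ≤ ell D := by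
  refine ⟨⌈Real.exp M⌉₊ + 1, fun D hD => ?_⟩
  have hD1 : (⌈Real.exp M⌉₊ : ℝ) + 1 ≤ D := by exact_mod_cast hD
  have hD0 : (0 : ℝ) < D := by linarith [Nat.le_ceil (Real.exp M), Real.exp_pos M]
  rw [ell, Real.le_log_iff_exp_le hD0]
  linarith [Nat.le_ceil (Real.exp M)]

/-! ## u042ᴿ²ᴱ from ANY producer of the smoothed-sum evaluation -/

open scoped Classical in
/-- **u042 with the two-piece error at the parameter `e″ = e1pp`, from ANY producer of the smoothed-sum
evaluation** (the algebra of `step16_u042R2E_of_repair` with the conclusion of `sumLtT_eval_of_repair` as a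
HYPOTHESIS `hsum`): `Eq16_15E e1pp → Inline16_nsetRemovableE e1pp → hsum → Step16_u042R2E e1pp`. So the chain
above (16.15) is insensitive to HOW `Σ_{n<T}ϖ₂ⱼ(ν∗χ)/n` is evaluated (typed u040/u041ᴿ, their rate-`𝓛⁻⁴` forms,
or any other route with error `O((1+|L′|)³𝓛⁻⁴)`). [cite: Zhang2022LandauSiegel, §16 p.94 (u042)] -/
theorem step16_u042R2E_of_sumLtT (h15 : Eq16_15E e1pp c') (hrem : Inline16_nsetRemovableE e1pp c')
    (hsum : ∃ C : ℝ, ForAllLarge fun D _ χ => AssumptionA D χ → ∀ j ∈ ({1, 2} : Finset ℕ),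
      ‖(∑ n ∈ Finset.Ico 1 ⌈bigT D⌉₊, varpi2 c' χ j n * nuConvChi χ n / (n : ℂ)) -
          (frakA χ : ℂ) / frakp χ * ((Nat.totient D : ℂ) / (D : ℂ)) * deriv χ.LFunction 1‖ ≤
        C * (1 + ‖deriv χ.LFunction 1‖) ^ 3 * (ell D ^ 4)⁻¹) :
    Step16_u042R2E e1pp c' := by
  obtain ⟨C₁, D₁, h₁⟩ := h15
  obtain ⟨C₂, D₂, h₂⟩ := hrem
  obtain ⟨C₀, D₀, h₀⟩ := hsum
  obtain ⟨D₃, hD₃⟩ := exists_forall_le_ell_W 1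
  set E : ℝ := ‖frakeE e1pp 1‖ + ‖frakeE e1pp 2‖ with hE
  refine ⟨max C₁ 0 + max C₂ 0 + E * max C₀ 0,
    max (max D₁ D₂) (max D₀ D₃), fun D _ χ hD hq hp hA j hj => ?_⟩
  have hD₁ : D₁ ≤ D := le_trans (le_trans (le_max_left _ _) (le_max_left _ _)) hD
  have hD₂ : D₂ ≤ D := le_trans (le_trans (le_max_right _ _) (le_max_left _ _)) hD
  have hD₀ : D₀ ≤ D := le_trans (le_trans (le_max_left _ _) (le_max_right _ _)) hD
  have hℓ1 : (1 : ℝ) ≤ ell D := hD₃ D (le_trans (le_trans (le_max_right _ _) (le_max_right _ _)) hD)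
  have hℓ0 : 0 < ell D := by linarith
  have hinv0 : 0 ≤ (ell D)⁻¹ := inv_nonneg.mpr hℓ0.le
  have e₁ := h₁ D χ hD₁ hq hp hA j hj
  have e₂ := h₂ D χ hD₂ hq hp hA j hj
  have e₀ := h₀ D χ hD₀ hq hp hA j hj
  have hEj : ‖frakeE e1pp j‖ ≤ E := norm_frakeE_le_of_mem e1pp hj
  set x : ℝ := ‖deriv χ.LFunction 1‖ with hx
  have hx0 : 0 ≤ x := norm_nonneg _
  set Y : ℝ := (1 + x) ^ 3 * (ell D ^ 4)⁻¹ with hY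
  have hY0 : 0 ≤ Y := by positivity
  -- abbreviations
  set A := ∑ n ∈ Finset.Ico 1 ⌈bigP D⌉₊, b1coef c' χ n * varpi2 c' χ j n / (n : ℂ) with hA'
  set F := ∑ n₁ ∈ (Finset.Ico 1 ⌈bigT D⌉₊).filter (fun n₁ => n₁ ∈ nset (frakq D)),
    varpi2 c' χ j n₁ * nuConvChi χ n₁ / (n₁ : ℂ) with hF
  set S := ∑ n ∈ Finset.Ico 1 ⌈bigT D⌉₊, varpi2 c' χ j n * nuConvChi χ n / (n : ℂ) with hS
  set M := (frakA χ : ℂ) / frakp χ * ((Nat.totient D : ℂ) / (D : ℂ)) * deriv χ.LFunction 1 with hM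
  have hmain : (frakA χ : ℂ) * frakeE e1pp j / frakp χ * ((Nat.totient D : ℂ) / (D : ℂ)) *
      deriv χ.LFunction 1 = frakeE e1pp j * M := by rw [hM]; ring
  rw [hmain]
  have hsplit : A - frakeE e1pp j * M = (A - frakeE e1pp j * F) +
      (frakeE e1pp j * F - frakeE e1pp j * S) + frakeE e1pp j * (S - M) := by ring
  have e₀' : ‖S - M‖ ≤ max C₀ 0 * Y := by
    refine le_trans e₀ ?_
    calc C₀ * (1 + x) ^ 3 * (ell D ^ 4)⁻¹ ≤ max C₀ 0 * (1 + x) ^ 3 * (ell D ^ 4)⁻¹ :=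
          mul_le_mul_of_nonneg_right (mul_le_mul_of_nonneg_right (le_max_left _ _) (by positivity))
            (inv_nonneg.mpr (pow_nonneg hℓ0.le 4))
      _ = max C₀ 0 * Y := by rw [hY]; ring
  have t3 : ‖frakeE e1pp j * (S - M)‖ ≤ E * max C₀ 0 * Y := by
    rw [norm_mul]
    calc ‖frakeE e1pp j‖ * ‖S - M‖ ≤ E * (max C₀ 0 * Y) :=
          mul_le_mul hEj e₀' (norm_nonneg _) (le_trans (norm_nonneg _) hEj)
      _ = E * max C₀ 0 * Y := by ring
  have t1 : ‖A - frakeE e1pp j * F‖ ≤ max C₁ 0 * (ell D)⁻¹ :=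
    le_trans e₁ (mul_le_mul_of_nonneg_right (le_max_left _ _) hinv0)
  have t2 : ‖frakeE e1pp j * F - frakeE e1pp j * S‖ ≤ max C₂ 0 * (ell D)⁻¹ :=
    le_trans e₂ (mul_le_mul_of_nonneg_right (le_max_left _ _) hinv0)
  have hC₁0 : 0 ≤ max C₁ 0 := le_max_right _ _
  have hC₂0 : 0 ≤ max C₂ 0 := le_max_right _ _
  have hC₀0 : 0 ≤ max C₀ 0 := le_max_right _ _
  have hE0 : 0 ≤ E := le_trans (norm_nonneg _) hEj
  calc ‖A - frakeE e1pp j * M‖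
      = ‖(A - frakeE e1pp j * F) + (frakeE e1pp j * F - frakeE e1pp j * S) +
          frakeE e1pp j * (S - M)‖ := by rw [hsplit]
    _ ≤ ‖A - frakeE e1pp j * F‖ + ‖frakeE e1pp j * F - frakeE e1pp j * S‖ +
          ‖frakeE e1pp j * (S - M)‖ := by
        have u1 : ‖(A - frakeE e1pp j * F) + (frakeE e1pp j * F - frakeE e1pp j * S)‖ ≤
            ‖A - frakeE e1pp j * F‖ + ‖frakeE e1pp j * F - frakeE e1pp j * S‖ := norm_add_le _ _
        have u2 := norm_add_le ((A - frakeE e1pp j * F) + (frakeE e1pp j * F - frakeE e1pp j * S))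
          (frakeE e1pp j * (S - M))
        linarith
    _ ≤ max C₁ 0 * (ell D)⁻¹ + max C₂ 0 * (ell D)⁻¹ + E * max C₀ 0 * Y := add_le_add (add_le_add t1 t2) t3
    _ ≤ (max C₁ 0 + max C₂ 0 + E * max C₀ 0) * ((ell D)⁻¹ + Y) := by
        nlinarith [mul_nonneg hC₁0 hY0, mul_nonneg hC₂0 hY0, mul_nonneg (mul_nonneg hE0 hC₀0) hinv0]
    _ = (max C₁ 0 + max C₂ 0 + E * max C₀ 0) *
          ((ell D)⁻¹ + (1 + x) ^ 3 * (ell D ^ 4)⁻¹) := by rw [hY]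

/-- **u042ᴿ²ᴱ with the smoothing steps at rate `𝓛⁻⁴`**: `Eq16_15E e1pp → Inline16_nsetRemovableE e1pp →
(u040a@𝓛⁻⁴) → (u040b@𝓛⁻⁴) → Step16_u041aR → Step16_u041bR → Step16_u042R2E e1pp`.
[cite: Zhang2022LandauSiegel, §16 p.94 (u042)] -/
theorem step16_u042R2E_of_repair_rate4 (h15 : Eq16_15E e1pp c') (hrem : Inline16_nsetRemovableE e1pp c')
    (h40a : ∃ C : ℝ, ForAllLarge fun D _ χ => AssumptionA D χ → ∀ j ∈ ({1, 2} : Finset ℕ),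
      ‖(∑ n ∈ Finset.Ico 1 ⌈bigT D⌉₊, varpi2 c' χ j n * nuConvChi χ n / (n : ℂ)) -
          ∑' n : ℕ, varpi2 c' χ j n * nuConvChi χ n / (n : ℂ) * (gW D (bigT D / n) : ℂ)‖ ≤
        C * (ell D ^ 4)⁻¹)
    (h40b : ∃ C : ℝ, ForAllLarge fun D _ χ => AssumptionA D χ → ∀ j ∈ ({1, 2} : Finset ℕ),
      ‖(∑' n : ℕ, varpi2 c' χ j n * nuConvChi χ n / (n : ℂ) * (gW D (bigT D / n) : ℂ)) -
          (1 / (2 * π) : ℂ) * ∫ v : ℝ, integrand16_u040 c' χ j (1 + v * I)‖ ≤ C * (ell D ^ 4)⁻¹)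
    (h41a : Step16_u041aR c') (h41b : Step16_u041bR c') : Step16_u042R2E e1pp c' :=
  step16_u042R2E_of_sumLtT e1pp c' h15 hrem (sumLtT_eval_of_repair_rate4 c' h40a h40b h41a h41b)

/-! ## The assembly of leaf h16_16's chain with the weak smoothing steps -/

/-- **RT-03 × RT-05 internal assembly with the smoothing steps at rate `𝓛⁻⁴`** (zl-libC-p5's proposal,
FINDING 2026-08-27T00:40Z: `u040a` is D-uniformly derivable at `C·𝓛^{−9.5}` — hence at `C·𝓛⁻⁴` with room —
but not at the printed `𝓛⁻¹⁰`): `Eq16_15E e1pp → Inline16_nsetRemovableE e1pp → (u040a@𝓛⁻⁴) →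
(u040b@𝓛⁻⁴) → Step16_u041aR → Lemma162R → Eq16_16R2E e1pp` — Lemma 16.1 is `AppendixA.lemma161_holds`,
`Step16_u041bR ⇐ Lemma162R` is `step16_u041bR_of_u039R ∘ step16_u039R_of_lemma162R`, the last step is
`eq16_16R2E_of` (Section16Eq1616R2E). At `e1pp = AppendixB.e1ppD` the conclusion is the skeleton binder of record
for leaf h16_16. [cite: Zhang2022LandauSiegel, §16 (16.13)–(16.16) pp.93–95] -/
theorem eq16_16R2E_of_subleaves_rate4 (h15 : Eq16_15E e1pp c') (hrem : Inline16_nsetRemovableE e1pp c')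
    (h40a : ∃ C : ℝ, ForAllLarge fun D _ χ => AssumptionA D χ → ∀ j ∈ ({1, 2} : Finset ℕ),
      ‖(∑ n ∈ Finset.Ico 1 ⌈bigT D⌉₊, varpi2 c' χ j n * nuConvChi χ n / (n : ℂ)) -
          ∑' n : ℕ, varpi2 c' χ j n * nuConvChi χ n / (n : ℂ) * (gW D (bigT D / n) : ℂ)‖ ≤
        C * (ell D ^ 4)⁻¹)
    (h40b : ∃ C : ℝ, ForAllLarge fun D _ χ => AssumptionA D χ → ∀ j ∈ ({1, 2} : Finset ℕ),
      ‖(∑' n : ℕ, varpi2 c' χ j n * nuConvChi χ n / (n : ℂ) * (gW D (bigT D / n) : ℂ)) -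
          (1 / (2 * π) : ℂ) * ∫ v : ℝ, integrand16_u040 c' χ j (1 + v * I)‖ ≤ C * (ell D ^ 4)⁻¹)
    (h41a : Step16_u041aR c') (h162 : Lemma162R c') : Eq16_16R2E e1pp c' :=
  eq16_16R2E_of e1pp c' (eq16_13_of_lemma161 c' (AppendixA.lemma161_holds c'))
    (step16_u042R2E_of_repair_rate4 e1pp c' h15 hrem h40a h40b h41a
      (step16_u041bR_of_u039R c' (step16_u039R_of_lemma162R c' h162)))
    (AppendixA.lemma161_holds c')

/-- **The same at the STATED constant** (`e1pp = e1ppj`; bridges `eq16_15E_e1ppj`,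
`inline16_nsetRemovableE_e1ppj`, `eq16_16R2E_e1ppj` are `rfl`): the printed-constant sub-leaves with the
smoothing steps at rate `𝓛⁻⁴` imply the v23+ binder `Typed.Section16B.Eq16_16R2 c′`.
[cite: Zhang2022LandauSiegel, §16 (16.16) p.95] -/
theorem eq16_16R2_of_subleaves_rate4 (h15 : Eq16_15 c') (hrem : Inline16_nsetRemovable c')
    (h40a : ∃ C : ℝ, ForAllLarge fun D _ χ => AssumptionA D χ → ∀ j ∈ ({1, 2} : Finset ℕ),
      ‖(∑ n ∈ Finset.Ico 1 ⌈bigT D⌉₊, varpi2 c' χ j n * nuConvChi χ n / (n : ℂ)) -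
          ∑' n : ℕ, varpi2 c' χ j n * nuConvChi χ n / (n : ℂ) * (gW D (bigT D / n) : ℂ)‖ ≤
        C * (ell D ^ 4)⁻¹)
    (h40b : ∃ C : ℝ, ForAllLarge fun D _ χ => AssumptionA D χ → ∀ j ∈ ({1, 2} : Finset ℕ),
      ‖(∑' n : ℕ, varpi2 c' χ j n * nuConvChi χ n / (n : ℂ) * (gW D (bigT D / n) : ℂ)) -
          (1 / (2 * π) : ℂ) * ∫ v : ℝ, integrand16_u040 c' χ j (1 + v * I)‖ ≤ C * (ell D ^ 4)⁻¹)
    (h41a : Step16_u041aR c') (h162 : Lemma162R c') : Eq16_16R2 c' := by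
  rw [← eq16_16R2E_e1ppj]
  exact eq16_16R2E_of_subleaves_rate4 e1ppj c' ((eq16_15E_e1ppj c').symm ▸ h15)
    ((inline16_nsetRemovableE_e1ppj c').symm ▸ hrem) h40a h40b h41a h162

-- Sanity: the rate-`𝓛⁻⁴` assembly subsumes the assembly of record (typed u040a/u040b feed it through the
-- two lifts) — `eq16_16R2E_of_subleaves` is recovered, so nothing landed is weakened.
example (h15 : Eq16_15E e1pp c') (hrem : Inline16_nsetRemovableE e1pp c') (h40a : Step16_u040a c')
    (h40b : Step16_u040b c') (h41a : Step16_u041aR c') (h162 : Lemma162R c') : Eq16_16R2E e1pp c' :=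
  eq16_16R2E_of_subleaves_rate4 e1pp c' h15 hrem (step16_u040a_rate4_of c' h40a)
    (step16_u040b_rate4_of c' h40b) h41a h162

/-! ## The `𝔫(𝔮)`-removal from its `𝔢`-free core, and the assembly from that core -/

open scoped Classical in
/-- **The `𝔢`-free CORE of "the constraint `n₁ ∈ 𝔫(𝔮)` can be removed" implies the node at EVERY parameter**:
if `‖Σ_{n₁<T, n₁∈𝒩(𝔮)} ϖ₂ⱼ(ν∗χ)(n₁)/n₁ − Σ_{n₁<T} ϖ₂ⱼ(ν∗χ)(n₁)/n₁‖ ≤ C𝓛⁻¹` (no `𝔢ⱼ` anywhere — the natural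
statement a prover of the removal establishes), then `Inline16_nsetRemovableE e1pp c′` for every `e1pp` (multiply by
`‖𝔢ⱼ[e1pp]‖ ≤ ‖𝔢₁[e1pp]‖ + ‖𝔢₂[e1pp]‖`). So ONE `𝔢`-free proof (zl-w16-p4's route, `Section16NsetRemovablePrep`)
serves the printed node (`e1pp = e1ppj`, below) and the E-rethread's instance `e1ppD` alike.
[cite: Zhang2022LandauSiegel, §16 p.94] -/
theorem inline16_nsetRemovableE_of_core
    (hcore : ∃ C : ℝ, ForAllLarge fun D _ χ => AssumptionA D χ → ∀ j ∈ ({1, 2} : Finset ℕ),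
      ‖(∑ n₁ ∈ (Finset.Ico 1 ⌈bigT D⌉₊).filter (fun n₁ => n₁ ∈ nset (frakq D)),
          varpi2 c' χ j n₁ * nuConvChi χ n₁ / (n₁ : ℂ)) -
        ∑ n₁ ∈ Finset.Ico 1 ⌈bigT D⌉₊, varpi2 c' χ j n₁ * nuConvChi χ n₁ / (n₁ : ℂ)‖ ≤ C * (ell D)⁻¹) :
    Inline16_nsetRemovableE e1pp c' := by
  obtain ⟨C, D₀, hC⟩ := hcore
  set E : ℝ := ‖frakeE e1pp 1‖ + ‖frakeE e1pp 2‖ with hE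
  refine ⟨E * max C 0, max D₀ 3, fun D _ χ hD hq hp hA j hj => ?_⟩
  have e := hC D χ (le_trans (le_max_left _ _) hD) hq hp hA j hj
  have hℓ0 : 0 < ell D := ell_pos_of_three_le_W (le_trans (le_max_right _ _) hD)
  have hinv0 : 0 ≤ (ell D)⁻¹ := inv_nonneg.mpr hℓ0.le
  have hEj : ‖frakeE e1pp j‖ ≤ E := norm_frakeE_le_of_mem e1pp hj
  rw [← mul_sub, norm_mul]
  calc ‖frakeE e1pp j‖ * ‖(∑ n₁ ∈ (Finset.Ico 1 ⌈bigT D⌉₊).filter (fun n₁ => n₁ ∈ nset (frakq D)),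
          varpi2 c' χ j n₁ * nuConvChi χ n₁ / (n₁ : ℂ)) -
        ∑ n₁ ∈ Finset.Ico 1 ⌈bigT D⌉₊, varpi2 c' χ j n₁ * nuConvChi χ n₁ / (n₁ : ℂ)‖
      ≤ E * (max C 0 * (ell D)⁻¹) :=
        mul_le_mul hEj (e.trans (mul_le_mul_of_nonneg_right (le_max_left _ _) hinv0)) (norm_nonneg _)
          (le_trans (norm_nonneg _) hEj)
    _ = E * max C 0 * (ell D)⁻¹ := by ring

open scoped Classical in
/-- The printed-constant node `Inline16_nsetRemovable c′` from the same `𝔢`-free core (instance `e1pp = e1ppj`,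
bridge `inline16_nsetRemovableE_e1ppj`, `rfl`). [cite: Zhang2022LandauSiegel, §16 p.94] -/
theorem inline16_nsetRemovable_of_core
    (hcore : ∃ C : ℝ, ForAllLarge fun D _ χ => AssumptionA D χ → ∀ j ∈ ({1, 2} : Finset ℕ),
      ‖(∑ n₁ ∈ (Finset.Ico 1 ⌈bigT D⌉₊).filter (fun n₁ => n₁ ∈ nset (frakq D)),
          varpi2 c' χ j n₁ * nuConvChi χ n₁ / (n₁ : ℂ)) -
        ∑ n₁ ∈ Finset.Ico 1 ⌈bigT D⌉₊, varpi2 c' χ j n₁ * nuConvChi χ n₁ / (n₁ : ℂ)‖ ≤ C * (ell D)⁻¹) :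
    Inline16_nsetRemovable c' := by
  rw [← inline16_nsetRemovableE_e1ppj]
  exact inline16_nsetRemovableE_of_core e1ppj c' hcore

open scoped Classical in
/-- **The most permissive assembly of leaf h16_16's chain at the parameter**: (16.15) at the parameter +
the `𝔢`-FREE core of the `𝔫(𝔮)`-removal + the smoothing steps at rate `𝓛⁻⁴` + `Step16_u041aR` + `Lemma162R`
⇒ `Eq16_16R2E e1pp c′`. Every planned sub-leaf producer plugs into this one (typed u040a/b via
`step16_u040a_rate4_of`/`step16_u040b_rate4_of`; zl-w16-p4's removal via its core; the E-rethread instantiates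
`e1pp := AppendixB.e1ppD`). [cite: Zhang2022LandauSiegel, §16 (16.13)–(16.16) pp.93–95] -/
theorem eq16_16R2E_of_subleaves_core (h15 : Eq16_15E e1pp c')
    (hremCore : ∃ C : ℝ, ForAllLarge fun D _ χ => AssumptionA D χ → ∀ j ∈ ({1, 2} : Finset ℕ),
      ‖(∑ n₁ ∈ (Finset.Ico 1 ⌈bigT D⌉₊).filter (fun n₁ => n₁ ∈ nset (frakq D)),
          varpi2 c' χ j n₁ * nuConvChi χ n₁ / (n₁ : ℂ)) -
        ∑ n₁ ∈ Finset.Ico 1 ⌈bigT D⌉₊, varpi2 c' χ j n₁ * nuConvChi χ n₁ / (n₁ : ℂ)‖ ≤ C * (ell D)⁻¹)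
    (h40a : ∃ C : ℝ, ForAllLarge fun D _ χ => AssumptionA D χ → ∀ j ∈ ({1, 2} : Finset ℕ),
      ‖(∑ n ∈ Finset.Ico 1 ⌈bigT D⌉₊, varpi2 c' χ j n * nuConvChi χ n / (n : ℂ)) -
          ∑' n : ℕ, varpi2 c' χ j n * nuConvChi χ n / (n : ℂ) * (gW D (bigT D / n) : ℂ)‖ ≤
        C * (ell D ^ 4)⁻¹)
    (h40b : ∃ C : ℝ, ForAllLarge fun D _ χ => AssumptionA D χ → ∀ j ∈ ({1, 2} : Finset ℕ),
      ‖(∑' n : ℕ, varpi2 c' χ j n * nuConvChi χ n / (n : ℂ) * (gW D (bigT D / n) : ℂ)) -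
          (1 / (2 * π) : ℂ) * ∫ v : ℝ, integrand16_u040 c' χ j (1 + v * I)‖ ≤ C * (ell D ^ 4)⁻¹)
    (h41a : Step16_u041aR c') (h162 : Lemma162R c') : Eq16_16R2E e1pp c' :=
  eq16_16R2E_of_subleaves_rate4 e1pp c' h15 (inline16_nsetRemovableE_of_core e1pp c' hremCore)
    h40a h40b h41a h162

/-! ## vs PRINT (R-23): the printed (16.16) implies the binder of record -/

/-- **Kernel certificate «print ⇒ binder» for RT-03** (R-23 vs-PRINT bookkeeping; zl-ref-x's ask, INBOX
2026-08-27T00:01:42Z): the PRINTED (16.16) `Eq16_16 c′` (uniform error `C·𝓛⁻⁴`) implies the two-piece binder of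
record `Eq16_16R2 c′` (error `C·(𝓛⁻¹ + (1+|L′(1,χ)|)³𝓛⁻⁴)`), since `𝓛⁻⁴ ≤ (1+|L′|)³𝓛⁻⁴ ≤ 𝓛⁻¹ + (1+|L′|)³𝓛⁻⁴`
(`C ↦ max C 0`). So the RT-03 re-type is a WEAKENING of the printed display, machine-checked. (The converse
direction `Eq16_16R2 → Eq16_16R` is the typer's `eq16_16R_of_eq16_16R2`.) [cite: Zhang2022LandauSiegel, §16 (16.16) p.95] -/
theorem eq16_16R2_of_eq16_16 (h : Eq16_16 c') : Eq16_16R2 c' := by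
  obtain ⟨C, D₀, hC⟩ := h
  refine ⟨max C 0, max D₀ 3, fun D _ χ hD hq hp hA j hj => ?_⟩
  have e := hC D χ (le_trans (le_max_left _ _) hD) hq hp hA j hj
  have hℓ0 : 0 < ell D := ell_pos_of_three_le_W (le_trans (le_max_right _ _) hD)
  set x : ℝ := ‖deriv χ.LFunction 1‖ with hx
  have hx0 : 0 ≤ x := norm_nonneg _
  have h4 : 0 ≤ (ell D ^ 4)⁻¹ := inv_nonneg.mpr (pow_nonneg hℓ0.le 4)
  have h1 : 0 ≤ (ell D)⁻¹ := inv_nonneg.mpr hℓ0.le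
  have hcube : 1 ≤ (1 + x) ^ 3 := one_le_pow₀ (le_add_of_nonneg_right hx0)
  have hmono : (ell D ^ 4)⁻¹ ≤ (ell D)⁻¹ + (1 + x) ^ 3 * (ell D ^ 4)⁻¹ := by
    have : (ell D ^ 4)⁻¹ ≤ (1 + x) ^ 3 * (ell D ^ 4)⁻¹ := by
      calc (ell D ^ 4)⁻¹ = 1 * (ell D ^ 4)⁻¹ := (one_mul _).symm
        _ ≤ (1 + x) ^ 3 * (ell D ^ 4)⁻¹ := mul_le_mul_of_nonneg_right hcube h4
    linarith
  calc ‖calS2 c' χ j - (frakA χ : ℂ) * frake j * ((Nat.totient D : ℂ) / (D : ℂ)) * deriv χ.LFunction 1‖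
      ≤ C * (ell D ^ 4)⁻¹ := e
    _ ≤ max C 0 * (ell D ^ 4)⁻¹ := mul_le_mul_of_nonneg_right (le_max_left _ _) h4
    _ ≤ max C 0 * ((ell D)⁻¹ + (1 + x) ^ 3 * (ell D ^ 4)⁻¹) :=
        mul_le_mul_of_nonneg_left hmono (le_max_right _ _)

/-- The same at EVERY parameter for the instance statements that share the printed constant: at `e1pp = e1ppj`,
`Eq16_16 c′ → Eq16_16R2E e1ppj c′` (bridge `eq16_16R2E_e1ppj`, `rfl`). [cite: Zhang2022LandauSiegel, §16 (16.16) p.95] -/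
theorem eq16_16R2E_e1ppj_of_eq16_16 (h : Eq16_16 c') : Eq16_16R2E e1ppj c' := by
  rw [eq16_16R2E_e1ppj]
  exact eq16_16R2_of_eq16_16 c' h

end Literature.NumberTheory.LFunctions.Zhang2022.Typed.Section16B

end
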